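import Summits.QuantumFields.YangMills.Theorems.LuscherReductionTwistedTraceScalingBOStiffFibreTail
import HarnessLib

/-!
# (B-ST) step (F)/(L-6) ingredient: THE FIBRE-MASS RATIO IS `1 + o(1)` — `∀ a > 0, ∀ᶠ β, M₂^γ ≤ (1 + a)·M₂^{γ,in}` (sharpening of `…BOMassRatioHodge.massRatio_le_two`)
# (lane A of S-BASE, crux `TwistedTraceScaling` stmt-QuantumFields-20203, C4-CORE, the (B-ST) pen; design card `Lines-BST-poincare.md` (F); HANDOFF-g21 STUB LEDGER (L-6))

The (B-ST) currency step (F) compares `c₁λ₀/K₁(1,1)` with `Λ_rec` to `1 + o(1)`; one factor is the fibre-mass ratio `M₂^γ/M₂^{γ,in}` (`M₂^γ = ∫ 𝟙_{‖x̂‖≤r_f} f dπ`,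
`M₂^{γ,in} = ∫ 𝟙_{‖x̂‖≤r_f/12} f dπ`, `f = (e^{−q_{β/2,β}})²·e^{−‖P_Γx̂‖²/β^{-2}}`), which `…BOMassRatioHodge.massRatio_le_two` bounds by `2`.  Here the sharp form:
★★ `massRatio_le_one_add` — for `L ≥ 2` and EVERY `a > 0`, eventually in `β`, `M₂^γ ≤ (1 + a)·M₂^{γ,in}`: the shell `r_f/12 < ‖x̂‖ ≤ r_f` carries at most `π(univ)·e^{−gap·ℓ²/144}`
(`…BOMassRatio.shell_integrand_le_of_hodge` with the landed Hodge lemma `…VacuumHodge.ker_covCurl_one_le`, `β·r_f² = ℓ²` by `…BODefectPieceRates.eventually_beta_mul_rf_sq`), while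
`M₂^{γ,in} ≥ e^{−99}c_b(β^{-1})^{6|E|}` (`…BODefectShellRate.inner_mass_poly_floor`), and `e^{−gap·ℓ²/144}` beats every power (`…BOStiffFibreTail.eventually_exp_neg_btLog_sq_le`).
Also `shell_mass_le` (the absolute shell bound, eventually) for re-use.
HONEST FRAMING: bookkeeping for a stub of a child of the CONDITIONAL route R2b1; (B-ST) OPEN; C4-CORE OPEN; not infinite volume, not a gap, not Clay.
-/

set_option autoImplicit false

noncomputable section

open MeasureTheory Filter Topology Real
open scoped BigOperators
open Literature.MathematicalPhysics.QuantumFieldTheory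
open Literature.MathematicalPhysics.QuantumLattice

namespace Summit.QuantumFields.YangMills.Theorems.FemtoTransferGap.TwoLattice.ConstTube

open Summit.QuantumFields.YangMills.Theorems.FemtoTransferGap
open Summit.QuantumFields.YangMills.Theorems.FemtoTransferGap.TwoLattice
open Summit.QuantumFields.YangMills.Theorems.FemtoTransferGap.TwoLattice.Avg
open Summit.QuantumFields.YangMills.Theorems.FemtoTransferGap.TwoLattice.Stiff
open Summit.QuantumFields.YangMills.Theorems.FemtoTransferGap.TwoLattice.GnChart
open Summit.QuantumFields.YangMills.Theorems.FemtoTransferGap.TwoLattice.Cov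
open Summit.QuantumFields.YangMills.Theorems.FemtoTransferGap.TwoLattice.Toron

variable {L : ℕ} [NeZero L]

/-- ★ **THE SHELL MASS, eventually**: for `L ≥ 2`, eventually in `β`,
`∫ 𝟙_{‖x̂‖≤r_f} f dπ ≤ ∫ 𝟙_{‖x̂‖≤r_f/12} f dπ + π(univ)·e^{−gap·ℓ²/144}`, `f = (e^{−q_{β/2,β}(x̂)})²·e^{−‖P_Γx̂‖²/β^{-2}}`, `gap = 2 − 2cos(2π/L)`. [cite: Luscher1983, §3] -/
theorem shell_mass_le (hL : 2 ≤ L) :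
    ∀ᶠ β : ℝ in atTop,
      ∫ v, {v : Edge 3 L → Fin 3 → ℝ | ‖linkEmbed L v‖ ≤ min (1 / 40) (powScale (1 / 2) β * btLog β)}.indicator (fun _ => (1 : ℝ)) v *
          (Real.exp (-(stiffGaussExp L (β / 2) β (linkEmbed L v))) ^ 2 * Real.exp (-(‖(gaugeModes L).starProjection (linkEmbed L v)‖ ^ 2 / powScale 1 β ^ 2))) ∂orthoTransverse L ≤
        ∫ v, {v : Edge 3 L → Fin 3 → ℝ | ‖linkEmbed L v‖ ≤ min (1 / 40) (powScale (1 / 2) β * btLog β) / 12}.indicator (fun _ => (1 : ℝ)) v *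
            (Real.exp (-(stiffGaussExp L (β / 2) β (linkEmbed L v))) ^ 2 * Real.exp (-(‖(gaugeModes L).starProjection (linkEmbed L v)‖ ^ 2 / powScale 1 β ^ 2))) ∂orthoTransverse L +
          (orthoTransverse L).real Set.univ * Real.exp (-((2 - 2 * Real.cos (2 * Real.pi / L)) / 144 * btLog β ^ 2)) := by
  haveI := isFiniteMeasure_orthoTransverse L
  set gap : ℝ := 2 - 2 * Real.cos (2 * Real.pi / L) with hgap
  have hgp : 0 < gap := gap_pos (L := L) hL
  set P : ℝ := (orthoTransverse L).real Set.univ with hPdef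
  filter_upwards [eventually_ge_atTop (max 1 gap), eventually_beta_mul_rf_sq] with β hβm hrf2
  have hβ1 : 1 ≤ β := le_trans (le_max_left _ _) hβm
  have hβg : gap ≤ β := le_trans (le_max_right _ _) hβm
  set rf : ℝ := min (1 / 40) (powScale (1 / 2) β * btLog β) with hrfdef
  have hrf0 : 0 ≤ rf := le_min (by norm_num) (mul_nonneg (powScale_pos _ _).le (le_trans zero_le_one (one_le_btLog β)))
  set f : (Edge 3 L → Fin 3 → ℝ) → ℝ := fun v => Real.exp (-(stiffGaussExp L (β / 2) β (linkEmbed L v))) ^ 2 *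
    Real.exp (-(‖(gaugeModes L).starProjection (linkEmbed L v)‖ ^ 2 / powScale 1 β ^ 2)) with hfdef
  have hfm : Measurable f := measurable_record_integrand (L := L) β
  have hf0 : ∀ v, 0 ≤ f v := fun v => by rw [hfdef]; positivity
  have hf1 : ∀ v, f v ≤ 1 := fun v => by
    rw [hfdef]; dsimp only
    have h1 : Real.exp (-(stiffGaussExp L (β / 2) β (linkEmbed L v))) ^ 2 ≤ 1 :=
      pow_le_one₀ (Real.exp_pos _).le (Real.exp_le_one_iff.mpr (neg_nonpos.mpr (stiffGaussExp_nonneg _ _ _)))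
    have h2 : Real.exp (-(‖(gaugeModes L).starProjection (linkEmbed L v)‖ ^ 2 / powScale 1 β ^ 2)) ≤ 1 := Real.exp_le_one_iff.mpr (neg_nonpos.mpr (by positivity))
    calc _ ≤ 1 * 1 := mul_le_mul h1 h2 (Real.exp_pos _).le zero_le_one
      _ = 1 := one_mul _
  set Sall := {v : Edge 3 L → Fin 3 → ℝ | ‖linkEmbed L v‖ ≤ rf} with hSall
  set Sin := {v : Edge 3 L → Fin 3 → ℝ | ‖linkEmbed L v‖ ≤ rf / 12} with hSin
  have hmSall : MeasurableSet Sall := measurableSet_le (measurable_linkEmbed L).norm measurable_const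
  have hmSin : MeasurableSet Sin := measurableSet_le (measurable_linkEmbed L).norm measurable_const
  have hI : ∀ S : Set (Edge 3 L → Fin 3 → ℝ), MeasurableSet S → Integrable (fun v => S.indicator (fun _ => (1 : ℝ)) v * f v) (orthoTransverse L) := fun S hS =>
    integrable_of_measurable_abs_le _ ((measurable_const.indicator hS).mul hfm) (C := 1) fun v => by
      rw [abs_mul, abs_of_nonneg (hf0 v)]
      by_cases h : v ∈ S
      · rw [Set.indicator_of_mem h, abs_one, one_mul]; exact hf1 v
      · rw [Set.indicator_of_notMem h, abs_zero, zero_mul]; exact zero_le_one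
  -- the exponent of record on the shell: `β·gap·(r_f/12)² = gap·ℓ²/144`
  have hexp : Real.exp (-(β * gap * (rf / 12) ^ 2)) = Real.exp (-(gap / 144 * btLog β ^ 2)) := by
    congr 1; rw [div_pow, show β * gap * (rf ^ 2 / 12 ^ 2) = gap / 144 * (β * rf ^ 2) by ring, hrf2]
  -- pointwise a.e. (balanced `v`): whole ball ≤ inner ball + shell constant
  have hae : ∀ᵐ v ∂orthoTransverse L, v ∈ capBalancedSet L := by rw [ae_iff]; exact orthoTransverse_compl_capBalancedSet L
  have hshell_pt : ∀ᵐ v ∂orthoTransverse L, Sall.indicator (fun _ => (1 : ℝ)) v * f v ≤ Sin.indicator (fun _ => (1 : ℝ)) v * f v + Real.exp (-(gap / 144 * btLog β ^ 2)) := by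
    filter_upwards [hae] with v hv
    by_cases hin' : v ∈ Sin
    · rw [Set.indicator_of_mem hin', one_mul]
      have : Sall.indicator (fun _ => (1 : ℝ)) v * f v ≤ f v := by
        by_cases h : v ∈ Sall
        · rw [Set.indicator_of_mem h, one_mul]
        · rw [Set.indicator_of_notMem h, zero_mul]; exact hf0 v
      linarith [Real.exp_pos (-(gap / 144 * btLog β ^ 2))]
    · rw [Set.indicator_of_notMem hin', zero_mul, zero_add]
      have hR : rf / 12 < ‖linkEmbed L v‖ := lt_of_not_ge hin'
      have hsh := shell_integrand_le_of_hodge (L := L) hL ker_covCurl_one_le hβ1 hβg hv.1 (by linarith) hR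
      rw [← hgap, hexp] at hsh
      calc Sall.indicator (fun _ => (1 : ℝ)) v * f v ≤ f v := by
            by_cases h : v ∈ Sall
            · rw [Set.indicator_of_mem h, one_mul]
            · rw [Set.indicator_of_notMem h, zero_mul]; exact hf0 v
        _ ≤ Real.exp (-(gap / 144 * btLog β ^ 2)) := hsh
  calc ∫ v, Sall.indicator (fun _ => (1 : ℝ)) v * f v ∂orthoTransverse L
      ≤ ∫ v, (Sin.indicator (fun _ => (1 : ℝ)) v * f v + Real.exp (-(gap / 144 * btLog β ^ 2))) ∂orthoTransverse L :=
        integral_mono_ae (hI Sall hmSall) ((hI Sin hmSin).add (integrable_const _)) hshell_pt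
    _ = ∫ v, Sin.indicator (fun _ => (1 : ℝ)) v * f v ∂orthoTransverse L + P * Real.exp (-(gap / 144 * btLog β ^ 2)) := by
        rw [integral_add (hI Sin hmSin) (integrable_const _), integral_const, smul_eq_mul, hPdef, mul_comm]

/-- ★★ **THE FIBRE-MASS RATIO IS `1 + o(1)`**: for `L ≥ 2` and every `a > 0`, eventually in `β`, `∫ 𝟙_{‖x̂‖≤r_f} f dπ ≤ (1 + a)·∫ 𝟙_{‖x̂‖≤r_f/12} f dπ`
(`f`, `r_f` as in `shell_mass_le`; sharp form of `…BOMassRatioHodge.massRatio_le_two`). [cite: Luscher1983, §3] -/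
theorem massRatio_le_one_add (hL : 2 ≤ L) {a : ℝ} (ha : 0 < a) :
    ∀ᶠ β : ℝ in atTop,
      ∫ v, {v : Edge 3 L → Fin 3 → ℝ | ‖linkEmbed L v‖ ≤ min (1 / 40) (powScale (1 / 2) β * btLog β)}.indicator (fun _ => (1 : ℝ)) v *
          (Real.exp (-(stiffGaussExp L (β / 2) β (linkEmbed L v))) ^ 2 * Real.exp (-(‖(gaugeModes L).starProjection (linkEmbed L v)‖ ^ 2 / powScale 1 β ^ 2))) ∂orthoTransverse L ≤
        (1 + a) * ∫ v, {v : Edge 3 L → Fin 3 → ℝ | ‖linkEmbed L v‖ ≤ min (1 / 40) (powScale (1 / 2) β * btLog β) / 12}.indicator (fun _ => (1 : ℝ)) v *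
            (Real.exp (-(stiffGaussExp L (β / 2) β (linkEmbed L v))) ^ 2 * Real.exp (-(‖(gaugeModes L).starProjection (linkEmbed L v)‖ ^ 2 / powScale 1 β ^ 2))) ∂orthoTransverse L := by
  haveI := isFiniteMeasure_orthoTransverse L
  have hgp : 0 < 2 - 2 * Real.cos (2 * Real.pi / L) := gap_pos (L := L) hL
  have hE : (0 : ℝ) < Fintype.card (Edge 3 L) := by exact_mod_cast Fintype.card_pos
  set cb : ℝ := Real.exp (-99) * ((1 / (20 * Fintype.card (Edge 3 L))) ^ 3 / 10) ^ Fintype.card (Edge 3 L) with hcbdef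
  have hcb : 0 < cb := by rw [hcbdef]; positivity
  have hbud := eventually_exp_neg_btLog_sq_le (q := (2 - 2 * Real.cos (2 * Real.pi / L)) / 144) (P := (orthoTransverse L).real Set.univ) (by positivity)
    measureReal_nonneg (mul_pos ha hcb) (6 * Fintype.card (Edge 3 L))
  filter_upwards [shell_mass_le (L := L) hL, inner_mass_poly_floor (L := L), hbud] with β hshell hfloor hb
  -- `shell ≤ a·floor ≤ a·M₂^{in}`
  have h1 : (orthoTransverse L).real Set.univ * Real.exp (-((2 - 2 * Real.cos (2 * Real.pi / L)) / 144 * btLog β ^ 2)) ≤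
      a * ∫ v, {v : Edge 3 L → Fin 3 → ℝ | ‖linkEmbed L v‖ ≤ min (1 / 40) (powScale (1 / 2) β * btLog β) / 12}.indicator (fun _ => (1 : ℝ)) v *
            (Real.exp (-(stiffGaussExp L (β / 2) β (linkEmbed L v))) ^ 2 * Real.exp (-(‖(gaugeModes L).starProjection (linkEmbed L v)‖ ^ 2 / powScale 1 β ^ 2))) ∂orthoTransverse L :=
    calc _ ≤ a * cb * powScale 1 β ^ (6 * Fintype.card (Edge 3 L)) := hb
      _ = a * (cb * powScale 1 β ^ (6 * Fintype.card (Edge 3 L))) := by ring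
      _ ≤ _ := mul_le_mul_of_nonneg_left (by rw [hcbdef]; exact hfloor) ha.le
  linarith

end Summit.QuantumFields.YangMills.Theorems.FemtoTransferGap.TwoLattice.ConstTube

end
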